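import Summits.QuantumFields.YangMills.Theses.OneCertifiedCube
import Summits.QuantumFields.YangMills.Theorems.OneCertifiedCubeFiniteSizeCriterion
import HarnessLib

/-!
# `CrossoverCertificate` — negative lemma modulo `GaplessWeakCouplingLimit`
# (the ∀-over-schemes certificate asserts a uniform lattice gap for EVERY weak-coupling scheme with a
# non-trivial non-Gaussian limit — including the asymptotic-freedom regime)

Crux `stmt-QuantumFields-16125` (`Summit.QuantumFields.YangMills.Theses.OneCertifiedCube.CrossoverCertificate`,
route `OneCertifiedCube`, rev 4/5): for EVERY compact simple `G`, EVERY faithful `r`, EVERY scheme `sch` with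
`β_k → ∞` and EVERY `T` with `IsYangMillsFor r sch T`, `T.IsNontrivial r.curvature`, `T.IsNonGaussian r.curvature`,
the total-variation finite-size condition holds eventually at the cells `b_k = ⌈ℓ/a_k⌉` of ONE physical length `ℓ`.

`crossoverCertificate_false_of_gaplessWeakCouplingLimit : GaplessWeakCouplingLimit → ¬ CrossoverCertificate` — the
crux is false MODULO `H = GaplessWeakCouplingLimit`: some admissible `G`, `r`, weak-coupling `sch` and `T` with
`IsYangMillsFor ∧ IsNontrivial ∧ IsNonGaussian` along which the lattice theories have NO volume-uniform mass gap at any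
physical rate (`∀ Δ > 0, ¬ HasLatticeMassGap r sch Δ`). Proof: the certificate of the crux for that scheme, fed to the
PROVED engine `FiniteSizeCriterion_proof` (item stmt-QuantumFields-8895), yields `HasLatticeMassGap r sch (κ/(2ℓ))`
exactly as the route's deciding theorem `closes` does (pair-independent threshold from the eventual certificate,
`a_k ≤ ℓ` and `(8n+7)ℓ ≤ a_k L_k`; `b_k a_k ≤ 2ℓ`, `(8n+7) b_k ≤ 2L_k + 1`). So, GIVEN the engine, the typed crux says:
every weak-coupling Wilson scheme whose limit passes the typed non-triviality clauses is lattice-gapped.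

Intended inhabitant of `H` (physics, not constructible in the tree): the ASYMPTOTIC-FREEDOM-REGIME schemes. Take
`β_k → ∞` so fast that the confinement length in lattice units `ξ_k = ξ(β_k)` satisfies `a_k ξ_k → ∞` (all probed
lattice distances `|x|/a_k ≪ ξ_k` are perturbative), `c_s ≡ 0` for every species but the curvature, and
`c_curv(k) ∝ g₀(a_k)⁻²`: the renormalised curvature `n`-point functions converge (asymptotic freedom, one gluon loop;
the running of `g` across the probed window is relatively `O(1/log(a_k ξ_k)) → 0`) to those of the Wick square
`:F²:` of `dim G` FREE Maxwell fields — OS data that PASS `IsNontrivial` (`⟨:F²:;:F²:⟩ = 2Σ⟨FF⟩² ∼ |x−y|⁻⁸ ≠ 0`) and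
`IsNonGaussian` (`κ₃(:F²:) ≠ 0`; `OSData.IsNonGaussian`'s own docstring: "the Wick square of a free field passes it"),
and are MASSLESS; on the lattice side the unrenormalised covariances are power-law `g₀⁴ n⁻⁸` in the window
`1/a_k ≪ n ≪ ξ_k`, which beats `C e^{−Δ a_k n}` on the large tori `S ≥ L_k` that `HasLatticeMassGap` quantifies over,
for every fixed `Δ > 0` and `C`. Rigorous status: open (Bałaban's ultraviolet stability and Magnen–Rivasseau–Sénéor's
infrared-cut-off `YM₄` are the nearest theorems; barrier `UVStabilityNonUniqueness`).

Class if `H` is ever inhabited: refuted-MISSTATED — the witness exploits the universal quantifier over `(r, sch, T)`: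
the statement `YangMills` needs the certificate along ONE scheme, and the typed clauses `IsNontrivial ∧ IsNonGaussian`
do not force the confining regime `a_k ≍ ξ_k⁻¹`. Repaired statement C′ (existential in the scheme; it absorbs the
route's existence leg `ContinuumLimitExists`, and `closes` adapts by taking the witness from C′ instead of E):
`∀ (G : Type) [Group G] [TopologicalSpace G] [IsTopologicalGroup G] [CompactSpace G] [MeasurableSpace G]
 [BorelSpace G], IsCompactSimpleLieGroup G → ∃ (r : LatticeRep G) (sch : SpeciesScheme (YMSpecies G))
 (T : OSData (YMSpecies G) 4), sch.HasWeakCouplingLimit ∧ IsYangMillsFor r sch T ∧ T.IsNontrivial r.curvature ∧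
 T.IsNonGaussian r.curvature ∧ ∃ ℓ : ℝ, 0 < ℓ ∧ ∃ (n : ℕ) (ε : ℝ), 1 ≤ n ∧ 0 ≤ ε ∧ ε·M(n) < 1 ∧
 ∀ᶠ k in atTop, ⟨the TV finite-size condition at b_k = ⌈ℓ/a_k⌉₊, verbatim⟩`;
the asymptotic-freedom witness misses C′ (C′ only needs the confining-regime scheme). Same shape as the sibling route
`CertificationLength`'s legs (A)+(L). Nothing here asserts a Theses statement; `GaplessWeakCouplingLimit` is the one
new `Prop`, an `@[conjecture]` obligation node kept inline (as `StandardScalingSU` in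
`LatticeGapInUVUnits/Negative/LatticeGapInUVUnitsFalseOfStandardScalingSU.lean`). CONTRAPOSITIVE (for planners): a
proof of the crux AS TYPED, composed with the engine, proves that EVERY weak-coupling Wilson scheme with a
non-trivial non-Gaussian limit is lattice-gapped — i.e. refutes the asymptotic-freedom-regime limit.
-/

noncomputable section

namespace Summit.QuantumFields.YangMills.Theorems.CrossoverCertificate.Negative

open MeasureTheory Filter Topology
open Literature.MathematicalPhysics.QuantumFieldTheory

/-- **H — `GaplessWeakCouplingLimit`: a gapless weak-coupling Wilson scheme with a non-trivial non-Gaussian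
Yang–Mills-labelled limit.** There are an admissible gauge group `G` (`IsCompactSimpleLieGroup`), a faithful lattice
representation `r`, a sequential Wilson scheme `sch` at weak coupling (`β_k → ∞`) and OS data `T` with
`IsYangMillsFor r sch T`, `T.IsNontrivial r.curvature`, `T.IsNonGaussian r.curvature`, along which the lattice
theories have no volume-uniform mass gap at any physical rate: `∀ Δ > 0, ¬ HasLatticeMassGap r sch Δ`.
Intended inhabitant: a scheme in the asymptotic-freedom regime (`β_k → ∞` with `a_k ξ(β_k) → ∞`, curvature
renormalised by `g₀(a_k)⁻²`, all other species by `0`), whose limit is the Wick square of free Maxwell fields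
(massless, yet `IsNontrivial` and `IsNonGaussian` as typed) and whose lattice covariances are power-law below the
confinement length. Universally expected and OPEN as a theorem: the convergence of the renormalised curvature
correlations in the perturbative window is asymptotic freedom made rigorous at the level of Schwinger functions
(Jaffe–Witten §1 "asymptotic freedom", §6 continuum limit of the lattice regularisation; nearest theorems:
Bałaban's ultraviolet stability of 4-d lattice gauge theory and Magnen–Rivasseau–Sénéor's `YM₄` with an infrared
cutoff, neither of which delivers the limit of correlation functions; Gross–Wilczek for the perturbative
statement). Not constructible in the tree today; this is the hypothesis `H` of the negative lemma
`crossoverCertificate_false_of_gaplessWeakCouplingLimit : H → ¬ CrossoverCertificate`, deliberately with no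
`_holds`. [cite: JaffeWitten2000, §1 and §6] [cite: MagnenRivasseauSeneor1993, Thm. 1]
[cite: Balaban1988Convergent, §1] [cite: GrossWilczek1973, (1)–(3)] -/
@[conjecture] def GaplessWeakCouplingLimit : Prop :=
  ∃ (G : Type) (_ : Group G) (_ : TopologicalSpace G) (_ : IsTopologicalGroup G) (_ : CompactSpace G)
    (_ : MeasurableSpace G) (_ : BorelSpace G),
    IsCompactSimpleLieGroup G ∧
    ∃ (r : LatticeRep G) (sch : SpeciesScheme (YMSpecies G)) (T : OSData (YMSpecies G) 4),
      sch.HasWeakCouplingLimit ∧ IsYangMillsFor r sch T ∧ T.IsNontrivial r.curvature ∧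
        T.IsNonGaussian r.curvature ∧ ∀ Δ : ℝ, 0 < Δ → ¬ HasLatticeMassGap r sch Δ

/-- **From a certificate to the uniform lattice gap** (the lattice half of the route's deciding theorem `closes`,
isolated): if the TV finite-size condition of `CrossoverCertificate` holds eventually along `sch` at the cells
`⌈ℓ/a_k⌉₊` with `ε M(n) < 1`, then the proved engine `FiniteSizeCriterion_proof` gives
`HasLatticeMassGap r sch (κ/(2ℓ))` for its rate `κ = κ(n, ε) > 0`. [folklore] -/
theorem hasLatticeMassGap_of_certificate {G : Type} [Group G] [TopologicalSpace G] [IsTopologicalGroup G]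
    [CompactSpace G] [MeasurableSpace G] [BorelSpace G] (r : LatticeRep G) (sch : SpeciesScheme (YMSpecies G))
    {ℓ : ℝ} (hℓ : 0 < ℓ) {n : ℕ} {ε : ℝ} (hn : 1 ≤ n) (hε : 0 ≤ ε)
    (hM : ε * ((((4 * n + 3) ^ 4 - (4 * n + 1) ^ 4 : ℕ)) : ℝ) < 1)
    (hev : ∀ᶠ k : ℕ in Filter.atTop, (∀ w : Fin 4 → ℤ → ℤ, (∀ i j, w i j + ((⌈ℓ / sch.a k⌉₊ : ℕ) : ℤ) ≤ w i (j + 1) ∧ w i (j + 1) ≤ w i j + 2 * ((⌈ℓ / sch.a k⌉₊ : ℕ) : ℤ)) → ∀ Y : Finset (Fin 4 → ℤ), Y ⊆ (Fintype.piFinset fun _ : Fin 4 => Finset.Icc (-(2 * ((n : ℕ) : ℤ))) (2 * ((n : ℕ) : ℤ))) → (0 : Fin 4 → ℤ) ∈ Y → ∀ η η' : Literature.MathematicalPhysics.QuantumLattice.LGConfig 4 G, (∀ e ∈ (Fintype.piFinset fun _ : Fin 4 => Finset.Icc (-(2 * ((n : ℕ) : ℤ))) (2 * ((n : ℕ) :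 ℤ))).biUnion (fun y : Fin 4 → ℤ => (Fintype.piFinset fun i : Fin 4 => Finset.Ico (w i (y i)) (w i (y i + 1))) ×ˢ (Finset.univ : Finset (Fin 4))), η e = η' e) → ∀ f : Literature.MathematicalPhysics.QuantumLattice.LGConfig 4 G → ℝ, Literature.MathematicalPhysics.QuantumLattice.IsCylinder f ((fun y : Fin 4 → ℤ => (Fintype.piFinset fun i : Fin 4 => Finset.Ico (w i (y i)) (w i (y i + 1))) ×ˢ (Finset.univ : Finset (Fin 4))) 0) → Measurable f → (∀ U, 0 ≤ f U ∧ f U ≤ 1) → |(∫ U, f U ∂(Literature.MathematicalPhysics.QuantumLattice.ymSpecification r.ρ (sch.β k) (Y.biUnion (fun y : Fin 4 → ℤ => (Fintype.piFinset fun i : Fin 4 => Finset.Ico (w i (y i)) (w i (y i + 1))) ×ˢ (Finset.univ : Finset (Fin 4)))) η)) - ∫ U, f U ∂(Literature.MathematicalPhysics.QuantumLattice.ymSpecification r.ρ (sch.β k) (Y.biUnion (fun y : Fin 4 → ℤ => (Fintype.piFinset fun i : Fin 4 => Finset.Ico (w i (y i)) (w i (y i + 1))) ×ˢ (Finset.univ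 : Finset (Fin 4)))) η')| ≤ ε)) :
    ∃ κ : ℝ, 0 < κ ∧ HasLatticeMassGap r sch (κ / (2 * ℓ)) := by
  obtain ⟨κ, hκ, hF'⟩ := FiniteSizeCriterion_proof n ε hn hε hM
  have hAB := hF' G r.N r.ρ r.continuous r.injective
  refine ⟨κ, hκ, ?_⟩
  have ev1 : ∀ᶠ k in Filter.atTop, sch.a k ≤ ℓ := sch.tendsto_a.eventually (eventually_le_nhds hℓ)
  have ev2 : ∀ᶠ k in Filter.atTop, ((8 * (n : ℝ) + 7) * ℓ) ≤ sch.a k * (sch.L k : ℝ) :=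
    sch.tendsto_L.eventually (Filter.eventually_ge_atTop _)
  obtain ⟨k₀, hk₀⟩ := Filter.eventually_atTop.mp ((hev.and ev1).and ev2)
  intro A B
  obtain ⟨C, hCb⟩ := hAB A B
  refine ⟨C, Filter.eventually_atTop.mpr ⟨k₀, fun k hk0 S hS t ht => ?_⟩⟩
  obtain ⟨⟨hk, h1⟩, h2⟩ := hk₀ k hk0
  have ha : 0 < sch.a k := sch.a_pos k
  have hq : 0 < ℓ / sch.a k := div_pos hℓ ha
  have hb1 : 1 ≤ ⌈ℓ / sch.a k⌉₊ := Nat.one_le_iff_ne_zero.mpr (Nat.pos_iff_ne_zero.mp (Nat.ceil_pos.mpr hq))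
  have hble : ((⌈ℓ / sch.a k⌉₊ : ℕ) : ℝ) ≤ ℓ / sch.a k + 1 := (Nat.ceil_lt_add_one hq.le).le
  have hbpos : (0 : ℝ) < ((⌈ℓ / sch.a k⌉₊ : ℕ) : ℝ) := by exact_mod_cast hb1
  have hab : ((⌈ℓ / sch.a k⌉₊ : ℕ) : ℝ) * sch.a k ≤ 2 * ℓ := by
    calc ((⌈ℓ / sch.a k⌉₊ : ℕ) : ℝ) * sch.a k ≤ (ℓ / sch.a k + 1) * sch.a k := by gcongr
      _ = ℓ + sch.a k := by field_simp
      _ ≤ 2 * ℓ := by linarith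
  have hside : (8 * n + 7) * ⌈ℓ / sch.a k⌉₊ ≤ 2 * S + 1 := by
    have hreal : ((8 * (n : ℝ) + 7)) * ((⌈ℓ / sch.a k⌉₊ : ℕ) : ℝ) ≤ 2 * (sch.L k : ℝ) + 1 := by
      have h3 : ((8 * (n : ℝ) + 7) * ((⌈ℓ / sch.a k⌉₊ : ℕ) : ℝ)) * sch.a k
          ≤ (2 * (sch.L k : ℝ)) * sch.a k := by
        calc ((8 * (n : ℝ) + 7) * ((⌈ℓ / sch.a k⌉₊ : ℕ) : ℝ)) * sch.a k
            = (8 * (n : ℝ) + 7) * (((⌈ℓ / sch.a k⌉₊ : ℕ) : ℝ) * sch.a k) := by ring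
          _ ≤ (8 * (n : ℝ) + 7) * (2 * ℓ) := by gcongr
          _ = 2 * ((8 * (n : ℝ) + 7) * ℓ) := by ring
          _ ≤ 2 * (sch.a k * (sch.L k : ℝ)) := by gcongr
          _ = (2 * (sch.L k : ℝ)) * sch.a k := by ring
      have h4 : (8 * (n : ℝ) + 7) * ((⌈ℓ / sch.a k⌉₊ : ℕ) : ℝ) ≤ 2 * (sch.L k : ℝ) :=
        le_of_mul_le_mul_right h3 ha
      linarith
    have hSL : (2 * (sch.L k : ℝ) + 1) ≤ 2 * (S : ℝ) + 1 := by
      have : (sch.L k : ℝ) ≤ S := by exact_mod_cast hS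
      linarith
    have hnat : (8 * n + 7) * ⌈ℓ / sch.a k⌉₊ ≤ 2 * sch.L k + 1 := by exact_mod_cast hreal
    omega
  have hbound := hCb (sch.β k) ⌈ℓ / sch.a k⌉₊ hb1 hk S hside t ht
  have hC0 : 0 ≤ C := by
    have h0 : 0 ≤ C * Real.exp (-(κ * (t : ℝ) / ((⌈ℓ / sch.a k⌉₊ : ℕ) : ℝ))) :=
      (abs_nonneg _).trans hbound
    exact nonneg_of_mul_nonneg_left h0 (Real.exp_pos _)
  refine hbound.trans ?_
  gcongr
  have ht0 : (0 : ℝ) ≤ (t : ℝ) := by exact_mod_cast Nat.zero_le t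
  rw [div_mul_eq_mul_div, div_le_div_iff₀ (by positivity) hbpos]
  calc κ * (sch.a k * (t : ℝ)) * ((⌈ℓ / sch.a k⌉₊ : ℕ) : ℝ)
      = κ * (t : ℝ) * (((⌈ℓ / sch.a k⌉₊ : ℕ) : ℝ) * sch.a k) := by ring
    _ ≤ κ * (t : ℝ) * (2 * ℓ) := by gcongr

/-- **`¬ CrossoverCertificate` modulo `GaplessWeakCouplingLimit`.** If some weak-coupling Wilson scheme with a
non-trivial non-Gaussian Yang–Mills-labelled limit has no volume-uniform lattice mass gap — the expected situation in
the asymptotic-freedom regime, where the limit is the massless free-gluon composite — then the crux AS TYPED (∀ over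
`(r, sch, T)`) is false: its certificate for that scheme would give `HasLatticeMassGap r sch (κ/(2ℓ))` through the
proved engine. Composing with an inhabitant of `H` is the real refutation (class refuted-misstated; repair: the
existential form C′ of the module docstring). [folklore] -/
theorem crossoverCertificate_false_of_gaplessWeakCouplingLimit (h : GaplessWeakCouplingLimit) :
    ¬ Summit.QuantumFields.YangMills.Theses.OneCertifiedCube.CrossoverCertificate := by
  intro hC
  obtain ⟨G, _, _, _, _, _, _, hG, r, sch, T, hW, hYM, hNT, hNG, hno⟩ := h
  obtain ⟨ℓ, hℓ, n, ε, hn, hε, hM, hev⟩ := hC G hG r sch T hW hYM hNT hNG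
  obtain ⟨κ, hκ, hgap⟩ := hasLatticeMassGap_of_certificate r sch hℓ hn hε hM hev
  exact hno (κ / (2 * ℓ)) (by positivity) hgap

end Summit.QuantumFields.YangMills.Theorems.CrossoverCertificate.Negative

end
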